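import Summits.MatrixMultiplication.MatrixMultiplication.Theorems.AbelianSTPPCensusTALin1200Defs2

/-!
# T_A/1200 certificate: kernel evaluation, volumes `712 … 795` (fine segments)

Cell mm-stpp (rung F-M1), T_A/1200 = «no abelian STPP host of order `≤ 1200` beats `τ = 2.371`»; checker in `AbelianSTPPCensusTALin1200Defs.lean`,
fine checkpoint states in `…TALin1200Defs2.lean`.  `decide` with kernel reduction (standard axioms; no `native_decide`); at most `120` sorted
candidate shapes per segment and `Elab.async false` (one kernel evaluation in memory at a time) — the 50-volume segments above volume `400`
exhausted kernel memory on some gate nodes.  Each segment recomputes the next checkpoint from the previous one and checks every sorted candidate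
shape of its volumes at every order `576 … 1200`; consumed by `TALin1200.seg_sound` / `TALin1200.loopL_sound` in
`AbelianSTPPCensusLeafTA1200Closed.lean`.
WHAT THIS IS NOT: arithmetic on shape lists only; no statement about STPP families or `ω`.
-/

set_option linter.dupNamespace false
set_option autoImplicit false
set_option Elab.async false

namespace Summit.MatrixMultiplication.MatrixMultiplication.Theorems.TALin1200

set_option maxHeartbeats 0 in
/-- Segment `712 … 730` (120 sorted shapes): from `st711` the loop reaches `st730`, all checks at orders `576 … 1200` passing. [original] -/
theorem sg712 : loopL 576 625 19 712 st711 = (true, st730) := by decide +kernel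

set_option maxHeartbeats 0 in
/-- Segment `731 … 755` (117 sorted shapes): from `st730` the loop reaches `st755`, all checks at orders `576 … 1200` passing. [original] -/
theorem sg731 : loopL 576 625 25 731 st730 = (true, st755) := by decide +kernel

set_option maxHeartbeats 0 in
/-- Segment `756 … 774` (120 sorted shapes): from `st755` the loop reaches `st774`, all checks at orders `576 … 1200` passing. [original] -/
theorem sg756 : loopL 576 625 19 756 st755 = (true, st774) := by decide +kernel

set_option maxHeartbeats 0 in
/-- Segment `775 … 795` (119 sorted shapes): from `st774` the loop reaches `st795`, all checks at orders `576 … 1200` passing. [original] -/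
theorem sg775 : loopL 576 625 21 775 st774 = (true, st795) := by decide +kernel

end Summit.MatrixMultiplication.MatrixMultiplication.Theorems.TALin1200
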